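import Summits.MatrixMultiplication.MatrixMultiplication.Theorems.ObstructionDescentCornerEquations
import Summits.MatrixMultiplication.MatrixMultiplication.Theorems.ObstructionDescentTraceDiagrams

set_option linter.dupNamespace false

/-!
# `E ⟹ E^Tr ⟹ E_stab`: the degree axis read in trace diagrams, and the aside `StableTraceIdentitiesBlind`
(decomp-mm · lens 3 · gen 19; route `route-MatrixMultiplication-ObstructionDescent`)

Thin route-level corollaries of the route-independent kernel `ObstructionDescentTraceDiagrams` (cycle formula) and the
corner form of `E = NoPolyDegreeObstruction` (`ObstructionDescentCornerEquations.noPolyDegreeObstruction_iff_corner`):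

* `traceIdentitiesBlind_of_noPolyDegreeObstruction` — **`E ⟹ E^Tr`**: at every cell `(n, m)` of the degree axis
  (`n ≥ n₀`, `n² ≤ m`, `n^τ ≤ m`) every trace relation `Σ_σ c_σ Tr_σ` of degree `d ≤ m^c` valid on the tensors of rank
  `≤ m` of `(ℂ^{n×n})^{⊗3}` has cycle-generating number `Σ_σ c_σ n^{cyc σ_κ + cyc σ_μ + cyc σ_ν} = 0`.  (In print the
  converse holds too — Reynolds operator of the reductive stabiliser `GL_n³` of `⟨n,n,n⟩` + first fundamental theorem
  [LandsbergGCT2017, Prop. 4.1.3.1, §8.3] — so `E^Tr` is `E` in its stabiliser-invariant normal form; only `E ⟹ E^Tr` is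
  claimed in the kernel.)
* `stableTraceIdentitiesBlind_of_noPolyDegreeObstruction` — **`E ⟹ E_stab`** = the route aside
  `StableTraceIdentitiesBlind` (item `stmt-MatrixMultiplication-27205`): the relations valid at EVERY level `ℓ` are in
  particular valid at level `n`.

[cite: LandsbergGCT2017, Prop. 4.1.3.1, §8.3.2 (p. 226); Lebruyn2008, p. 39, p. 100; Procesi1976; Razmyslov1974]
-/

noncomputable section

open scoped BigOperators
open Finset

namespace Summit.MatrixMultiplication.MatrixMultiplication.Theorems.ObstructionDescentTraceDiagramsBlind

open Literature.Computability.AlgebraicComplexity (tensorRank matMulTensor)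
open Summit.MatrixMultiplication.MatrixMultiplication.Theses.ObstructionDescent
  (NoPolyDegreeObstruction StableTraceIdentitiesBlind)
open Summit.MatrixMultiplication.MatrixMultiplication.Theorems.ObstructionDescentCornerEquations
  (noPolyDegreeObstruction_iff_corner)
open Summit.MatrixMultiplication.MatrixMultiplication.Theorems.ObstructionDescentTraceDiagrams
  (traceRelation_blind_of_cornerCell)

/-- **`E ⟹ E^Tr`** (level-`n` trace identities of polynomial degree are blind at `⟨n,n,n⟩` on the degree axis).
[cite: LandsbergGCT2017, §8.3.2 (p. 226); Lebruyn2008, p. 100] -/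
theorem traceIdentitiesBlind_of_noPolyDegreeObstruction (hE : NoPolyDegreeObstruction) :
    ∀ c : ℕ, ∀ τ : ℝ, 2 < τ → ∃ n₀ : ℕ, ∀ n m d : ℕ, n₀ ≤ n → n * n ≤ m → (n : ℝ) ^ τ ≤ (m : ℝ) → d ≤ m ^ c →
      ∀ S : Finset (Equiv.Perm (Fin d) × Equiv.Perm (Fin d) × Equiv.Perm (Fin d)),
      ∀ coef : Equiv.Perm (Fin d) × Equiv.Perm (Fin d) × Equiv.Perm (Fin d) → ℂ,
        (∀ t : (Fin n × Fin n) → (Fin n × Fin n) → (Fin n × Fin n) → ℂ, tensorRank t ≤ m →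
          ∑ σ ∈ S, coef σ * ∑ κ : Fin d → Fin n, ∑ μ : Fin d → Fin n, ∑ ν : Fin d → Fin n,
            ∏ s : Fin d, t (κ s, ν s) (κ (σ.1 s), μ s) (μ (σ.2.1 s), ν (σ.2.2 s)) = 0) →
        ∑ σ ∈ S, coef σ * (n : ℂ) ^
          ((σ.1.cycleFactorsFinset.card + (univ.filter fun x : Fin d => σ.1 x = x).card) +
            (σ.2.1.cycleFactorsFinset.card + (univ.filter fun x : Fin d => σ.2.1 x = x).card) +
            (σ.2.2.cycleFactorsFinset.card + (univ.filter fun x : Fin d => σ.2.2 x = x).card)) = 0 := by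
  intro c τ hτ
  obtain ⟨n₀, hn₀⟩ := (noPolyDegreeObstruction_iff_corner.1 hE) c τ hτ
  refine ⟨n₀, fun n m d hn hnm hτm hd S coef hS => ?_⟩
  exact traceRelation_blind_of_cornerCell (hn₀ n m hn hnm hτm) hd S coef hS

/-- **`E ⟹ E_stab`**: the degree axis implies the aside `StableTraceIdentitiesBlind` (level-free trace identities of
polynomial degree are blind at `⟨n,n,n⟩`) — instantiate the all-levels hypothesis at the level `ℓ := n`.
[cite: LandsbergGCT2017, Prop. 4.1.3.1; Procesi1976; Razmyslov1974] -/
theorem stableTraceIdentitiesBlind_of_noPolyDegreeObstruction (hE : NoPolyDegreeObstruction) :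
    StableTraceIdentitiesBlind := by
  intro c τ hτ
  obtain ⟨n₀, hn₀⟩ := traceIdentitiesBlind_of_noPolyDegreeObstruction hE c τ hτ
  refine ⟨n₀, fun n m d hn hnm hτm hd coef hstab => ?_⟩
  exact hn₀ n m d hn hnm hτm hd Finset.univ coef (hstab n)

end Summit.MatrixMultiplication.MatrixMultiplication.Theorems.ObstructionDescentTraceDiagramsBlind
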